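import Mathlib

/-!
# Route LiouvilleSarnak — crux `LiouvilleCutRank` (stmt-ValiantsHypothesis-14775), barrier:
# PAIR CORRELATIONS CANNOT SEE RANK ONE

The crux `LiouvilleCutRank` asks that the digital cut matrices of the Liouville function have
unbounded rank; by `OneBlock.liouvilleCutRank_iff_oneBlock_distinctRows` a proof needs, for each cut
word `π₁`, ONE aligned block `B_H(r, c) = λ(4^ℓ H + N_{π₁}(r, c) + 1)` with many distinct rows, and
`…FourPointLogChowla.lean` shows that logarithmically averaged FOUR-point correlations along the
progressions `n ≡ b (mod 4^ℓ)` suffice.  This file records why ORDER TWO can never suffice, for any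
argument that only uses averages of pair products `B(u) B(v)` of block entries.

* §1 `sum_sign_mul_sign` — on the cube `{±1}^ι` (uniform sign vectors `x`), `Σ_x x_r x_{r'}` is
  `2^{|ι|}` if `r = r'` and `0` otherwise (flip the coordinate `r`).
* §2 ★ `rankOne_pairSum` / `uniform_pairSum` / `rankOne_pairSum_eq_uniform` — PAIR ISOTROPY OF
  RANK-ONE SIGN BLOCKS: for the uniform measure on rank-one sign matrices `B = x yᵀ`
  (`x ∈ {±1}^ι`, `y ∈ {±1}^κ` uniform) and for the uniform measure on ALL sign matrices `M` on
  `ι × κ`, the pair correlations coincide: `E[B(r,c) B(r',c')] = [r = r'][c = c'] = E[M(r,c) M(r',c')]`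
  (stated cross-multiplied by the sizes `2^{|ι|} 2^{|κ|}` and `2^{|ι||κ|}` of the two ensembles, in `ℤ`).
* §3 `pairStatistic_rankOne_eq_uniform` — hence EVERY pair statistic `Σ_{u,v} w(u,v) B(u) B(v)`
  (arbitrary integer weights `w`) has the same average over rank-one sign blocks as over all sign
  blocks.

Reading (the barrier).  A hypothesis about `λ` that only constrains averages — over blocks `H`,
scales, cut words, residue classes — of pair statistics of the blocks `B_H` is satisfied in
expectation by the model "every aligned block is an independent uniformly random RANK-ONE sign
matrix" exactly as well as by the model "uniformly random signs"; so no such hypothesis can by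
itself force a single block of `π₁`-rank `≥ 2`, let alone the crux.  Order-two inputs in this sense
include the logarithmically averaged two-point Chowla/Elliott theorem of Tao WITH DILATIONS
(proved in the tree: `Literature.NumberTheory.Sieve.tao_log_chowla_liouville_holds`), its
quantitative form (Helfgott–Radziwiłł), and variance / almost-all statements for `λ` in arithmetic
progressions or short intervals (Matomäki–Radziwiłł, Klurman–Mangerel–Teräväinen), all of which are
second moments.  Together with Tao–Teräväinen's theorem for ODD orders, this places the minimal
correlation input for `LiouvilleCutRank` at order FOUR — the hypothesis of `…FourPointLogChowla.lean`.

Honest framing: an elementary second-moment computation about random sign matrices; it is a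
statement about classes of hypotheses (what they can distinguish in expectation), not about `λ`,
and it does not exclude arguments that combine order-two input with multiplicativity in new ways.
`LiouvilleCutRank` stays OPEN; nothing here bears on VP versus VNP.  No definitions (the sign of a
Boolean is written `if b then 1 else -1`).
-/

-- the directory `ValiantsHypothesis/ValiantsHypothesis` repeats the summit name (tree layout)
set_option linter.dupNamespace false

namespace Summit.ValiantsHypothesis.ValiantsHypothesis.Theorems.LiouvilleSarnakLiouvilleCutRank.PairCorrelationBarrier

open Finset

/-! ### §1 Pair sums on the sign cube -/

/-- The square of a sign is `1`. [folklore] -/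
theorem sign_mul_self (b : Bool) : (if b then (1 : ℤ) else -1) * (if b then (1 : ℤ) else -1) = 1 := by
  cases b <;> simp

/-- Flipping one coordinate of a Boolean vector is an involution. [folklore] -/
theorem flip_involutive {ι : Type*} [DecidableEq ι] (r : ι) :
    Function.Involutive fun x : ι → Bool => Function.update x r (!x r) := by
  intro x
  funext i
  by_cases hi : i = r
  · subst hi; simp
  · simp [Function.update_of_ne hi]

/-- ★ **Pair sums on the sign cube.**  `Σ_{x ∈ {±1}^ι} x_r x_{r'} = [r = r'] · 2^{|ι|}`: for `r = r'`
every term is `1`; for `r ≠ r'` the coordinate flip at `r` is a sign-reversing involution.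
[folklore] -/
theorem sum_sign_mul_sign {ι : Type*} [Fintype ι] [DecidableEq ι] (r r' : ι) :
    ∑ x : ι → Bool, (if x r then (1 : ℤ) else -1) * (if x r' then (1 : ℤ) else -1) =
      if r = r' then 2 ^ Fintype.card ι else 0 := by
  split_ifs with h
  · subst h
    rw [sum_congr rfl fun x _ => sign_mul_self (x r)]
    simp
  · -- the flip at `r` reverses the sign of every term
    have hflip : ∀ x : ι → Bool,
        (if Function.update x r (!x r) r then (1 : ℤ) else -1) *
            (if Function.update x r (!x r) r' then (1 : ℤ) else -1) =
          -((if x r then (1 : ℤ) else -1) * (if x r' then (1 : ℤ) else -1)) := by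
      intro x
      rw [Function.update_self, Function.update_of_ne (Ne.symm h)]
      cases x r <;> cases x r' <;> simp
    have h1 : ∑ x : ι → Bool, (if Function.update x r (!x r) r then (1 : ℤ) else -1) *
          (if Function.update x r (!x r) r' then (1 : ℤ) else -1) =
        ∑ x : ι → Bool, (if x r then (1 : ℤ) else -1) * (if x r' then (1 : ℤ) else -1) :=
      (flip_involutive r).bijective.sum_comp
        (fun x : ι → Bool => (if x r then (1 : ℤ) else -1) * (if x r' then (1 : ℤ) else -1))
    have h2 : ∑ x : ι → Bool, (if Function.update x r (!x r) r then (1 : ℤ) else -1) *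
          (if Function.update x r (!x r) r' then (1 : ℤ) else -1) =
        ∑ x : ι → Bool, -((if x r then (1 : ℤ) else -1) * (if x r' then (1 : ℤ) else -1)) :=
      sum_congr rfl fun x _ => hflip x
    rw [sum_neg_distrib] at h2
    linarith

/-! ### §2 Pair isotropy of rank-one sign blocks -/

/-- ★ **Pair correlations of uniform RANK-ONE sign blocks.**  Over all `x ∈ {±1}^ι`, `y ∈ {±1}^κ`,
`Σ_{x,y} (x_r y_c)(x_{r'} y_{c'}) = [r = r' ∧ c = c'] · 2^{|ι|} 2^{|κ|}`, i.e. the rank-one block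
`B = x yᵀ` has `E[B(r,c) B(r',c')] = [(r,c) = (r',c')]`. [folklore] -/
theorem rankOne_pairSum {ι κ : Type*} [Fintype ι] [Fintype κ] [DecidableEq ι] [DecidableEq κ]
    (r r' : ι) (c c' : κ) :
    ∑ x : ι → Bool, ∑ y : κ → Bool,
        ((if x r then (1 : ℤ) else -1) * (if y c then (1 : ℤ) else -1)) *
          ((if x r' then (1 : ℤ) else -1) * (if y c' then (1 : ℤ) else -1)) =
      if r = r' ∧ c = c' then 2 ^ Fintype.card ι * 2 ^ Fintype.card κ else 0 := by
  have hfac : ∑ x : ι → Bool, ∑ y : κ → Bool,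
      ((if x r then (1 : ℤ) else -1) * (if y c then (1 : ℤ) else -1)) *
        ((if x r' then (1 : ℤ) else -1) * (if y c' then (1 : ℤ) else -1)) =
      (∑ x : ι → Bool, (if x r then (1 : ℤ) else -1) * (if x r' then (1 : ℤ) else -1)) *
        ∑ y : κ → Bool, (if y c then (1 : ℤ) else -1) * (if y c' then (1 : ℤ) else -1) := by
    rw [sum_mul_sum]
    exact sum_congr rfl fun x _ => sum_congr rfl fun y _ => by ring
  rw [hfac, sum_sign_mul_sign, sum_sign_mul_sign]
  by_cases hr : r = r' <;> by_cases hc : c = c' <;> simp [hr, hc]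

/-- **Pair correlations of uniform sign blocks.**  Over all sign matrices `M` on `ι × κ`,
`Σ_M M(u) M(v) = [u = v] · 2^{|ι| |κ|}`. [folklore] -/
theorem uniform_pairSum {ι κ : Type*} [Fintype ι] [Fintype κ] [DecidableEq ι] [DecidableEq κ]
    (u v : ι × κ) :
    ∑ M : ι × κ → Bool, (if M u then (1 : ℤ) else -1) * (if M v then (1 : ℤ) else -1) =
      if u = v then 2 ^ (Fintype.card ι * Fintype.card κ) else 0 := by
  rw [sum_sign_mul_sign, Fintype.card_prod]

/-- ★ **Pair isotropy: rank-one blocks versus all blocks.**  Normalised by the sizes of the two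
ensembles (`2^{|ι|} 2^{|κ|}` rank-one blocks `x yᵀ` — counted with the multiplicity two of
`(x, y) ↦ x yᵀ`, which does not affect averages — and `2^{|ι||κ|}` sign matrices), the pair
correlations agree: `E_{rank one}[B(r,c) B(r',c')] = E_{uniform}[M(r,c) M(r',c')]` for all
`(r,c), (r',c')`.  Stated cross-multiplied, in `ℤ`. [folklore] -/
theorem rankOne_pairSum_eq_uniform {ι κ : Type*} [Fintype ι] [Fintype κ] [DecidableEq ι]
    [DecidableEq κ] (r r' : ι) (c c' : κ) :
    2 ^ (Fintype.card ι * Fintype.card κ) *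
        ∑ x : ι → Bool, ∑ y : κ → Bool,
          ((if x r then (1 : ℤ) else -1) * (if y c then (1 : ℤ) else -1)) *
            ((if x r' then (1 : ℤ) else -1) * (if y c' then (1 : ℤ) else -1)) =
      (2 ^ Fintype.card ι * 2 ^ Fintype.card κ) *
        ∑ M : ι × κ → Bool, (if M (r, c) then (1 : ℤ) else -1) * (if M (r', c') then (1 : ℤ) else -1) := by
  rw [rankOne_pairSum, uniform_pairSum]
  by_cases hr : r = r' <;> by_cases hc : c = c' <;> simp [hr, hc, mul_comm]

/-! ### §3 Every pair statistic has the same average over rank-one blocks as over all blocks -/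

/-- ★ **Pair statistics are blind to rank one.**  For arbitrary integer weights `w(u, v)` on pairs of
positions, the statistic `Σ_{u,v} w(u,v) B(u) B(v)` has the same average over uniformly random
RANK-ONE sign blocks `B = x yᵀ` as over uniformly random sign blocks (cross-multiplied form).  Hence
no hypothesis that only constrains such averages (two-point correlations of the block entries, in
any average over blocks) can force a block of rank `≥ 2`. [folklore] -/
theorem pairStatistic_rankOne_eq_uniform {ι κ : Type*} [Fintype ι] [Fintype κ] [DecidableEq ι]
    [DecidableEq κ] (w : ι × κ → ι × κ → ℤ) :
    2 ^ (Fintype.card ι * Fintype.card κ) *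
        ∑ x : ι → Bool, ∑ y : κ → Bool, ∑ u : ι × κ, ∑ v : ι × κ,
          w u v * (((if x u.1 then (1 : ℤ) else -1) * (if y u.2 then (1 : ℤ) else -1)) *
            ((if x v.1 then (1 : ℤ) else -1) * (if y v.2 then (1 : ℤ) else -1))) =
      (2 ^ Fintype.card ι * 2 ^ Fintype.card κ) *
        ∑ M : ι × κ → Bool, ∑ u : ι × κ, ∑ v : ι × κ,
          w u v * ((if M u then (1 : ℤ) else -1) * (if M v then (1 : ℤ) else -1)) := by
  -- (1) rank-one side: positions outside, weights out
  have hL : ∑ x : ι → Bool, ∑ y : κ → Bool, ∑ u : ι × κ, ∑ v : ι × κ,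
      w u v * (((if x u.1 then (1 : ℤ) else -1) * (if y u.2 then (1 : ℤ) else -1)) *
        ((if x v.1 then (1 : ℤ) else -1) * (if y v.2 then (1 : ℤ) else -1))) =
      ∑ u : ι × κ, ∑ v : ι × κ, w u v * ∑ x : ι → Bool, ∑ y : κ → Bool,
        ((if x u.1 then (1 : ℤ) else -1) * (if y u.2 then (1 : ℤ) else -1)) *
          ((if x v.1 then (1 : ℤ) else -1) * (if y v.2 then (1 : ℤ) else -1)) := by
    calc ∑ x : ι → Bool, ∑ y : κ → Bool, ∑ u : ι × κ, ∑ v : ι × κ,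
          w u v * (((if x u.1 then (1 : ℤ) else -1) * (if y u.2 then (1 : ℤ) else -1)) *
            ((if x v.1 then (1 : ℤ) else -1) * (if y v.2 then (1 : ℤ) else -1)))
        = ∑ x : ι → Bool, ∑ u : ι × κ, ∑ v : ι × κ, ∑ y : κ → Bool,
            w u v * (((if x u.1 then (1 : ℤ) else -1) * (if y u.2 then (1 : ℤ) else -1)) *
              ((if x v.1 then (1 : ℤ) else -1) * (if y v.2 then (1 : ℤ) else -1))) := by
          refine sum_congr rfl fun x _ => ?_
          rw [sum_comm]
          exact sum_congr rfl fun u _ => sum_comm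
      _ = ∑ u : ι × κ, ∑ x : ι → Bool, ∑ v : ι × κ, ∑ y : κ → Bool,
            w u v * (((if x u.1 then (1 : ℤ) else -1) * (if y u.2 then (1 : ℤ) else -1)) *
              ((if x v.1 then (1 : ℤ) else -1) * (if y v.2 then (1 : ℤ) else -1))) := sum_comm
      _ = ∑ u : ι × κ, ∑ v : ι × κ, ∑ x : ι → Bool, ∑ y : κ → Bool,
            w u v * (((if x u.1 then (1 : ℤ) else -1) * (if y u.2 then (1 : ℤ) else -1)) *
              ((if x v.1 then (1 : ℤ) else -1) * (if y v.2 then (1 : ℤ) else -1))) :=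
          sum_congr rfl fun u _ => sum_comm
      _ = _ := by
          refine sum_congr rfl fun u _ => sum_congr rfl fun v _ => ?_
          rw [mul_sum]
          exact sum_congr rfl fun x _ => by rw [mul_sum]
  -- (2) uniform side: positions outside, weights out
  have hR : ∑ M : ι × κ → Bool, ∑ u : ι × κ, ∑ v : ι × κ,
      w u v * ((if M u then (1 : ℤ) else -1) * (if M v then (1 : ℤ) else -1)) =
      ∑ u : ι × κ, ∑ v : ι × κ, w u v *
        ∑ M : ι × κ → Bool, (if M u then (1 : ℤ) else -1) * (if M v then (1 : ℤ) else -1) := by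
    calc ∑ M : ι × κ → Bool, ∑ u : ι × κ, ∑ v : ι × κ,
          w u v * ((if M u then (1 : ℤ) else -1) * (if M v then (1 : ℤ) else -1))
        = ∑ u : ι × κ, ∑ M : ι × κ → Bool, ∑ v : ι × κ,
            w u v * ((if M u then (1 : ℤ) else -1) * (if M v then (1 : ℤ) else -1)) := sum_comm
      _ = ∑ u : ι × κ, ∑ v : ι × κ, ∑ M : ι × κ → Bool,
            w u v * ((if M u then (1 : ℤ) else -1) * (if M v then (1 : ℤ) else -1)) :=
          sum_congr rfl fun u _ => sum_comm
      _ = _ := sum_congr rfl fun u _ => sum_congr rfl fun v _ => by rw [mul_sum]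
  -- (3) compare position by position with `rankOne_pairSum_eq_uniform`
  rw [hL, hR, mul_sum, mul_sum]
  refine sum_congr rfl fun u _ => ?_
  rw [mul_sum, mul_sum]
  refine sum_congr rfl fun v _ => ?_
  have key := rankOne_pairSum_eq_uniform u.1 v.1 u.2 v.2
  simp only [Prod.mk.eta] at key
  calc 2 ^ (Fintype.card ι * Fintype.card κ) * (w u v * ∑ x : ι → Bool, ∑ y : κ → Bool,
          ((if x u.1 then (1 : ℤ) else -1) * (if y u.2 then (1 : ℤ) else -1)) *
            ((if x v.1 then (1 : ℤ) else -1) * (if y v.2 then (1 : ℤ) else -1)))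
      = w u v * (2 ^ (Fintype.card ι * Fintype.card κ) * ∑ x : ι → Bool, ∑ y : κ → Bool,
          ((if x u.1 then (1 : ℤ) else -1) * (if y u.2 then (1 : ℤ) else -1)) *
            ((if x v.1 then (1 : ℤ) else -1) * (if y v.2 then (1 : ℤ) else -1))) := by ring
    _ = w u v * ((2 ^ Fintype.card ι * 2 ^ Fintype.card κ) *
          ∑ M : ι × κ → Bool, (if M u then (1 : ℤ) else -1) * (if M v then (1 : ℤ) else -1)) := by
          rw [key]
    _ = _ := by ring

/-! ### §4 Odd orders are blind as well; order four is the first moment that sees rank one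

Appended (same hand): the moment comparison is sharp.  All ODD-order statistics vanish identically
for both ensembles (the global sign flip `x ↦ -x`, resp. `M ↦ -M`, reverses every odd product), so
orders `1, 2, 3, 5, 7, …` cannot distinguish "every block is rank one" from "random signs" either —
consistent with Tao–Teräväinen's theorem that the odd-order logarithmic Chowla correlations of `λ`
DO vanish.  Order FOUR separates the ensembles: on a non-degenerate rectangle `r ≠ r'`, `c ≠ c'` the
rank-one product `B(r,c) B(r',c) B(r,c') B(r',c')` is identically `1`, while its uniform average is
`0` — exactly the rectangle statistic behind `GramCount.card_sq_le_of_image_card_le` and the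
four-point bridge `…FourPointLogChowla.lean`. -/

/-- Flipping every coordinate of a Boolean vector is an involution. [folklore] -/
theorem flipAll_involutive {α : Type*} : Function.Involutive fun x : α → Bool => fun i => !x i := by
  intro x
  funext i
  simp

/-- The sign of a negated Boolean is the negated sign. [folklore] -/
theorem sign_not (b : Bool) : (if (!b) then (1 : ℤ) else -1) = -(if b then (1 : ℤ) else -1) := by
  cases b <;> simp

/-- ★ **Odd products vanish on the sign cube.**  For an odd number `k` of (not necessarily distinct)
coordinates `u_i`, `Σ_{x ∈ {±1}^α} Π_i x_{u_i} = 0` (global flip). [folklore] -/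
theorem sum_prod_sign_eq_zero_of_odd {α : Type*} [Fintype α] [DecidableEq α] {k : ℕ}
    (hk : Odd k) (u : Fin k → α) :
    ∑ x : α → Bool, ∏ i, (if x (u i) then (1 : ℤ) else -1) = 0 := by
  have hflip : ∀ x : α → Bool,
      ∏ i, (if (fun j => !x j) (u i) then (1 : ℤ) else -1) =
        -∏ i, (if x (u i) then (1 : ℤ) else -1) := by
    intro x
    rw [show (∏ i, (if (fun j => !x j) (u i) then (1 : ℤ) else -1)) =
        ∏ i, -(if x (u i) then (1 : ℤ) else -1) from prod_congr rfl fun i _ => sign_not (x (u i)),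
      Finset.prod_neg, Finset.card_univ, Fintype.card_fin, hk.neg_one_pow]
    ring
  have h1 : ∑ x : α → Bool, ∏ i, (if (fun j => !x j) (u i) then (1 : ℤ) else -1) =
      ∑ x : α → Bool, ∏ i, (if x (u i) then (1 : ℤ) else -1) :=
    flipAll_involutive.bijective.sum_comp
      (fun x : α → Bool => ∏ i, (if x (u i) then (1 : ℤ) else -1))
  have h2 : ∑ x : α → Bool, ∏ i, (if (fun j => !x j) (u i) then (1 : ℤ) else -1) =
      ∑ x : α → Bool, -∏ i, (if x (u i) then (1 : ℤ) else -1) :=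
    sum_congr rfl fun x _ => hflip x
  rw [sum_neg_distrib] at h2
  linarith

/-- **Odd statistics of uniform sign blocks vanish.** [folklore] -/
theorem uniform_oddSum_eq_zero {ι κ : Type*} [Fintype ι] [Fintype κ] [DecidableEq ι]
    [DecidableEq κ] {k : ℕ} (hk : Odd k) (u : Fin k → ι × κ) :
    ∑ M : ι × κ → Bool, ∏ i, (if M (u i) then (1 : ℤ) else -1) = 0 :=
  sum_prod_sign_eq_zero_of_odd hk u

/-- ★ **Odd statistics of uniform RANK-ONE sign blocks vanish too.**  For `B = x yᵀ`,
`Σ_{x,y} Π_i B(u_i) = (Σ_x Π_i x_{r_i}) (Σ_y Π_i y_{c_i}) = 0` for odd `k` (the `x`-factor vanishes).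
So odd-order statistics, like pair statistics, cannot distinguish rank-one blocks from random
blocks. [folklore] -/
theorem rankOne_oddSum_eq_zero {ι κ : Type*} [Fintype ι] [Fintype κ] [DecidableEq ι]
    [DecidableEq κ] {k : ℕ} (hk : Odd k) (u : Fin k → ι × κ) :
    ∑ x : ι → Bool, ∑ y : κ → Bool,
        ∏ i, ((if x (u i).1 then (1 : ℤ) else -1) * (if y (u i).2 then (1 : ℤ) else -1)) = 0 := by
  have hfac : ∀ (x : ι → Bool) (y : κ → Bool),
      ∏ i, ((if x (u i).1 then (1 : ℤ) else -1) * (if y (u i).2 then (1 : ℤ) else -1)) =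
        (∏ i, (if x (u i).1 then (1 : ℤ) else -1)) * ∏ i, (if y (u i).2 then (1 : ℤ) else -1) :=
    fun x y => Finset.prod_mul_distrib
  simp_rw [hfac, ← mul_sum, ← sum_mul]
  rw [sum_prod_sign_eq_zero_of_odd hk (fun i => (u i).1), zero_mul]

/-- ★ **Order four separates the ensembles.**  On a non-degenerate rectangle (`r ≠ r'`, `c ≠ c'`)
the rank-one rectangle product `B(r,c) B(r',c) B(r,c') B(r',c') = (x_r x_{r'})² (y_c y_{c'})²` is
identically `1`, so its ensemble sum is the full count `2^{|ι|} 2^{|κ|}` … [folklore] -/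
theorem rankOne_rectangleSum {ι κ : Type*} [Fintype ι] [Fintype κ] [DecidableEq ι] [DecidableEq κ]
    (r r' : ι) (c c' : κ) :
    ∑ x : ι → Bool, ∑ y : κ → Bool,
        ((if x r then (1 : ℤ) else -1) * (if y c then (1 : ℤ) else -1)) *
          ((if x r' then (1 : ℤ) else -1) * (if y c then (1 : ℤ) else -1)) *
          ((if x r then (1 : ℤ) else -1) * (if y c' then (1 : ℤ) else -1)) *
          ((if x r' then (1 : ℤ) else -1) * (if y c' then (1 : ℤ) else -1)) =
      2 ^ Fintype.card ι * 2 ^ Fintype.card κ := by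
  have hone : ∀ (x : ι → Bool) (y : κ → Bool),
      ((if x r then (1 : ℤ) else -1) * (if y c then (1 : ℤ) else -1)) *
          ((if x r' then (1 : ℤ) else -1) * (if y c then (1 : ℤ) else -1)) *
          ((if x r then (1 : ℤ) else -1) * (if y c' then (1 : ℤ) else -1)) *
          ((if x r' then (1 : ℤ) else -1) * (if y c' then (1 : ℤ) else -1)) = 1 := by
    intro x y
    cases x r <;> cases x r' <;> cases y c <;> cases y c' <;> simp
  simp_rw [hone]
  simp

/-- … whereas over ALL sign blocks the same rectangle statistic averages to `0` as soon as the
four positions are distinct (flip the entry at `(r, c)`; here `r ≠ r'` and `c ≠ c'`).  This rectangle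
statistic is the one the Gram count of `…GramCount.lean` exploits. [folklore] -/
theorem uniform_rectangleSum_eq_zero {ι κ : Type*} [Fintype ι] [Fintype κ] [DecidableEq ι]
    [DecidableEq κ] (r r' : ι) (c c' : κ) (hr : r ≠ r') (hc : c ≠ c') :
    ∑ M : ι × κ → Bool,
        (if M (r, c) then (1 : ℤ) else -1) * (if M (r', c) then (1 : ℤ) else -1) *
          (if M (r, c') then (1 : ℤ) else -1) * (if M (r', c') then (1 : ℤ) else -1) = 0 := by
  have h1 : (r', c) ≠ (r, c) := fun h => hr (Prod.mk.inj h).1.symm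
  have h2 : (r, c') ≠ (r, c) := fun h => hc (Prod.mk.inj h).2.symm
  have h3 : (r', c') ≠ (r, c) := fun h => hr (Prod.mk.inj h).1.symm
  -- flip the entry at `(r, c)`
  have hflip : ∀ M : ι × κ → Bool,
      (if Function.update M (r, c) (!M (r, c)) (r, c) then (1 : ℤ) else -1) *
            (if Function.update M (r, c) (!M (r, c)) (r', c) then (1 : ℤ) else -1) *
          (if Function.update M (r, c) (!M (r, c)) (r, c') then (1 : ℤ) else -1) *
          (if Function.update M (r, c) (!M (r, c)) (r', c') then (1 : ℤ) else -1) =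
        -((if M (r, c) then (1 : ℤ) else -1) * (if M (r', c) then (1 : ℤ) else -1) *
          (if M (r, c') then (1 : ℤ) else -1) * (if M (r', c') then (1 : ℤ) else -1)) := by
    intro M
    rw [Function.update_self, Function.update_of_ne h1, Function.update_of_ne h2,
      Function.update_of_ne h3]
    cases M (r, c) <;> cases M (r', c) <;> cases M (r, c') <;> cases M (r', c') <;> simp
  have e1 := (flip_involutive (r, c)).bijective.sum_comp
    (fun M : ι × κ → Bool => (if M (r, c) then (1 : ℤ) else -1) * (if M (r', c) then (1 : ℤ) else -1) *
      (if M (r, c') then (1 : ℤ) else -1) * (if M (r', c') then (1 : ℤ) else -1))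
  have e2 : ∑ M : ι × κ → Bool,
      (if Function.update M (r, c) (!M (r, c)) (r, c) then (1 : ℤ) else -1) *
            (if Function.update M (r, c) (!M (r, c)) (r', c) then (1 : ℤ) else -1) *
          (if Function.update M (r, c) (!M (r, c)) (r, c') then (1 : ℤ) else -1) *
          (if Function.update M (r, c) (!M (r, c)) (r', c') then (1 : ℤ) else -1) =
      ∑ M : ι × κ → Bool, -((if M (r, c) then (1 : ℤ) else -1) * (if M (r', c) then (1 : ℤ) else -1) *
          (if M (r, c') then (1 : ℤ) else -1) * (if M (r', c') then (1 : ℤ) else -1)) :=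
    sum_congr rfl fun M _ => hflip M
  rw [sum_neg_distrib] at e2
  have e1' : ∑ M : ι × κ → Bool,
      (if Function.update M (r, c) (!M (r, c)) (r, c) then (1 : ℤ) else -1) *
            (if Function.update M (r, c) (!M (r, c)) (r', c) then (1 : ℤ) else -1) *
          (if Function.update M (r, c) (!M (r, c)) (r, c') then (1 : ℤ) else -1) *
          (if Function.update M (r, c) (!M (r, c)) (r', c') then (1 : ℤ) else -1) =
      ∑ M : ι × κ → Bool, (if M (r, c) then (1 : ℤ) else -1) * (if M (r', c) then (1 : ℤ) else -1) *
          (if M (r, c') then (1 : ℤ) else -1) * (if M (r', c') then (1 : ℤ) else -1) := e1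
  linarith

end Summit.ValiantsHypothesis.ValiantsHypothesis.Theorems.LiouvilleSarnakLiouvilleCutRank.PairCorrelationBarrier
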